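import Literature.AlgebraicGeometry.Modules.ModuleCechFiniteOfProper
import Mathlib.AlgebraicGeometry.Morphisms.Separated
import HarnessLib

/-!
# Finite affine covers with affine finite intersections, for quasi-compact separated morphisms to an affine base

[Hartshorne1977] III Prop. 8.7 (proof) / [StacksProject, Tag 01KP]: a scheme quasi-compact and SEPARATED over an affine base
has a finite affine open cover all of whose non-empty finite intersections are affine — the input «`(U) (hcov) (hUa)`» of the
cell's Čech files (★ `Modules/ModuleSectionsFlatBaseChange.exists_tensor_secMod_top_linearEquiv_of_flat` = flat base change of
`H⁰`, ★ `Morphisms/SectionsLiftOfFibreVanishing`, …), which ★ `Morphisms/SectionsLiftOfFibreVanishing.exists_finite_affine_cover_cechOpen`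
records for PROPER `g`.  THIS FILE weakens «proper» to «quasi-compact and separated» (the same proof: Mathlib
`QuasiCompact.compactSpace_of_compactSpace`, `Scheme.isSeparated_iff`, `IsAffineOpen.biInf`) and adds the form over an AFFINE OPEN
`V ⊆ S` of an arbitrary base (`p ∣_ V`), which is what a Zariski-localised base-change argument reads:

* `exists_finite_affine_cover_cechOpen_of_isSeparated (g : X ⟶ B) [IsAffine B] [QuasiCompact g] [IsSeparated g]`;
* `exists_finite_affine_cover_cechOpen_restrict (p : X ⟶ S) [QuasiCompact p] [IsSeparated p] (hV : IsAffineOpen V)` — for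
  `↑(p⁻¹V)`.

Theorems only; no `sorry`, no instance, no named fact.  Universe `Scheme.{0}` / `ι : Type` as in the Čech files.  Cell
hodgecm-mathlib, F-DAG (h2)/(h6-d) input (L2′) for the flat base change corollary (B-plan1 (g15) 05:45Z).  HC_CM is proved only
modulo the printed citations until rung 0 closes; this file discharges none of them.

## References
* [Hartshorne1977] R. Hartshorne, *Algebraic Geometry* (1977), III Prop. 8.7 (proof), II Ex. 4.3 (affine intersections in a
  separated scheme).
* [StacksProject] The Stacks Project, Tag 01KP (Lemma 26.21.7).
-/

noncomputable section

open CategoryTheory CategoryTheory.Limits AlgebraicGeometry TopologicalSpace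

namespace Literature.AlgebraicGeometry.Morphisms

open Literature.AlgebraicGeometry.Modules

/-- **A scheme quasi-compact and separated over an affine base has a finite affine open cover all of whose non-empty finite
intersections are affine** ([Hartshorne1977] III Prop. 8.7 (proof), II Ex. 4.3; [StacksProject, Tag 01KP]) — the proof of ★
`exists_finite_affine_cover_cechOpen` with «proper» weakened to «quasi-compact + separated».
[cite: Hartshorne1977, III Prop. 8.7 (proof)] [cite: StacksProject, Tag 01KP] -/
theorem exists_finite_affine_cover_cechOpen_of_isSeparated {X B : Scheme.{0}} (g : X ⟶ B) [IsAffine B] [QuasiCompact g]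
    [IsSeparated g] :
    ∃ (ι : Type) (_ : Fintype ι) (_ : LinearOrder ι) (U : ι → X.Opens), (⨆ i, U i) = ⊤ ∧
      ∀ s : Finset ι, s.Nonempty → IsAffineOpen (cechOpen U s) := by
  haveI : CompactSpace X := QuasiCompact.compactSpace_of_compactSpace g
  haveI : X.IsSeparated := by
    rw [Scheme.isSeparated_iff, ← terminal.comp_from g]; infer_instance
  let 𝒰 := X.affineCover.finiteSubcover
  letI : Fintype 𝒰.I₀ := Fintype.ofFinite _
  letI : LinearOrder 𝒰.I₀ := LinearOrder.lift' (Fintype.equivFin 𝒰.I₀) (Fintype.equivFin 𝒰.I₀).injective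
  have hUi : ∀ i, IsAffineOpen (𝒰.f i).opensRange := fun i => isAffineOpen_opensRange (𝒰.f i)
  refine ⟨𝒰.I₀, inferInstance, inferInstance, fun i => (𝒰.f i).opensRange, 𝒰.iSup_opensRange, fun s hs => ?_⟩
  rw [← faceSet_eq_cechOpen]
  exact IsAffineOpen.biInf (s : Set 𝒰.I₀) s.finite_toSet hs fun i _ => hUi i

/-- **Over an affine open `V ⊆ S`**: for `p : X ⟶ S` quasi-compact and separated and `V` an affine open of `S`, the open
subscheme `p⁻¹V` has a finite affine open cover with affine non-empty finite intersections (apply the previous result to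
`p ∣_ V : p⁻¹V ⟶ V`). [cite: Hartshorne1977, III Prop. 8.7 (proof)] [cite: StacksProject, Tag 01KP] -/
theorem exists_finite_affine_cover_cechOpen_restrict {X S : Scheme.{0}} (p : X ⟶ S) [QuasiCompact p] [IsSeparated p]
    {V : S.Opens} (hV : IsAffineOpen V) :
    ∃ (ι : Type) (_ : Fintype ι) (_ : LinearOrder ι) (U : ι → (p ⁻¹ᵁ V : Scheme.{0}).Opens), (⨆ i, U i) = ⊤ ∧
      ∀ s : Finset ι, s.Nonempty → IsAffineOpen (cechOpen U s) := by
  haveI : IsAffine (V : Scheme.{0}) := hV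
  exact exists_finite_affine_cover_cechOpen_of_isSeparated (p ∣_ V)

end Literature.AlgebraicGeometry.Morphisms

end
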